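import Literature.Combinatorics.SetFamily.SpreadLemma
import Literature.Computability.Complexity.RossmanMonotoneCliqueGraphs
import HarnessLib

/-!
# Cliques minus an edge and the spread of their families (Rossman 2010, §6, Lemma 15)

Finite combinatorics for the first half of Rossman's proof of Theorem 1 (Lemma 15, p. 9):

* `onSet_update_false`, `card_onSet_update_false`, `supp_update_cliqueVec` (a `k`-clique minus
  an edge still has all `k` vertices non-isolated, `k ≥ 3`), `card_onSet_cliqueVec_le`;
* `verts Z` — the vertices covered by a set `Z` of potential edges, `card_le_choose_card_verts`;
* `card_filter_supset_mul_pow_le : #{A ∈ ([n] choose k) : S ⊆ A} · n^{|S|} ≤ k^{|S|} C(n,k)`;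
* `isSpread_of_le` (spreadness is monotone in the parameter) and
  `isSpread_image_of_clique_family` — the edge sets of a family `{Q_A : A ∈ Bad}` of subgraphs
  `Q_A ⊆ K_A` with `supp Q_A = A` (cliques minus an edge), indexed by a `θ`-dense family `Bad`
  of `k`-sets, form an `R`-spread family as soon as `R^{|Z|} k^{|V(Z)|} ≤ θ n^{|V(Z)|}` for the
  relevant `Z` — the input to the spread lemma replacing "a standard application of Janson's
  inequality" in the proof of Lemma 15.

## References

* B. Rossman, *The monotone complexity of k-clique on random graphs*, FOCS 2010 (full version
  2009), §6, Lemma 15 (p. 9) [Rossman2010].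
-/

noncomputable section

namespace Literature.Computability.Complexity

open Finset Literature.Combinatorics.SetFamily

variable {n : ℕ}

/-! ### Cliques and cliques minus an edge -/

/-- The edge set of `K_A` is the set of potential edges inside `A`. [folklore] -/
theorem onSet_cliqueVec (A : Finset (Fin n)) : onSet (cliqueVec A) = edgesIn A := by
  ext e
  rw [mem_onSet, cliqueVec_eq_true_iff_endpts, edgesIn, mem_filter]
  simp

/-- `|E(K_A)| ≤ C(|A|, 2)`. [folklore] -/
theorem card_onSet_cliqueVec_le (A : Finset (Fin n)) : #(onSet (cliqueVec A)) ≤ (#A).choose 2 := by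
  rw [onSet_cliqueVec]; exact card_edgesIn_le A

/-- Switching off one edge erases it from the edge set. [folklore] -/
theorem onSet_update_false (x : (⊤ : SimpleGraph (Fin n)).edgeSet → Bool)
    (e : (⊤ : SimpleGraph (Fin n)).edgeSet) : onSet (Function.update x e false) = (onSet x).erase e := by
  ext e'
  rw [mem_onSet, mem_erase, mem_onSet]
  by_cases h : e' = e
  · subst h; simp
  · rw [Function.update_of_ne h]; simp [h]

/-- Switching off an on-edge removes exactly one edge. [folklore] -/
theorem card_onSet_update_false {x : (⊤ : SimpleGraph (Fin n)).edgeSet → Bool}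
    {e : (⊤ : SimpleGraph (Fin n)).edgeSet} (he : x e = true) :
    #(onSet (Function.update x e false)) + 1 = #(onSet x) := by
  rw [onSet_update_false, card_erase_add_one ((mem_onSet x e).2 he)]

/-- Switching off an edge gives a subgraph. [folklore] -/
theorem update_false_le (x : (⊤ : SimpleGraph (Fin n)).edgeSet → Bool)
    (e : (⊤ : SimpleGraph (Fin n)).edgeSet) : Function.update x e false ≤ x := by
  intro e'
  by_cases h : e' = e
  · subst h; simp
  · rw [Function.update_of_ne h]

/-- **A `k`-clique minus an edge has all `k` vertices non-isolated** (`k ≥ 3`): every vertex of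
`A` keeps an edge to one of two other vertices of `A`. [folklore] -/
theorem supp_update_cliqueVec {A : Finset (Fin n)} (hA : 3 ≤ #A) (e : (⊤ : SimpleGraph (Fin n)).edgeSet) :
    supp (Function.update (cliqueVec A) e false) = A := by
  refine Subset.antisymm ((supp_mono (update_false_le _ e)).trans (supp_cliqueVec_subset A)) ?_
  intro u hu
  -- two further vertices of `A`
  obtain ⟨B, hBA, hB2⟩ : ∃ B ⊆ A.erase u, #B = 2 :=
    exists_subset_card_eq (by rw [card_erase_of_mem hu]; omega)
  obtain ⟨v, w, hvw, rfl⟩ := card_eq_two.1 hB2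
  have hv : v ∈ A.erase u := hBA (by simp)
  have hw : w ∈ A.erase u := hBA (by simp)
  rw [mem_erase] at hv hw
  have hev : s(u, v) ∈ (⊤ : SimpleGraph (Fin n)).edgeSet := by simpa using (Ne.symm hv.1)
  have hew : s(u, w) ∈ (⊤ : SimpleGraph (Fin n)).edgeSet := by simpa using (Ne.symm hw.1)
  have hne : (⟨s(u, v), hev⟩ : (⊤ : SimpleGraph (Fin n)).edgeSet) ≠ ⟨s(u, w), hew⟩ := by
    intro h
    have h' : s(u, v) = s(u, w) := congrArg Subtype.val h
    rw [Sym2.congr_right] at h'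
    exact hvw h'
  have hon : ∀ {z : Fin n} (hz : z ∈ A) (hzu : z ≠ u) (hedge : s(u, z) ∈ (⊤ : SimpleGraph (Fin n)).edgeSet),
      (⟨s(u, z), hedge⟩ : (⊤ : SimpleGraph (Fin n)).edgeSet) ≠ e →
      u ∈ supp (Function.update (cliqueVec A) e false) := by
    intro z hz hzu hedge hne'
    rw [mem_supp]
    refine ⟨⟨s(u, z), hedge⟩, ?_, Sym2.mem_mk_left u z⟩
    rw [Function.update_of_ne hne', cliqueVec_eq_true_iff_endpts]
    intro y hy
    simp only [mem_endpts, Sym2.mem_iff] at hy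
    rcases hy with rfl | rfl
    · exact hu
    · exact hz
  by_cases h1 : (⟨s(u, v), hev⟩ : (⊤ : SimpleGraph (Fin n)).edgeSet) = e
  · exact hon hw.2 hw.1 hew (fun h2 => hne (h1.trans h2.symm))
  · exact hon hv.2 hv.1 hev h1

/-! ### Vertices covered by a set of potential edges -/

/-- The vertices covered by a set `Z` of potential edges. [folklore] -/
def verts (Z : Finset ((⊤ : SimpleGraph (Fin n)).edgeSet)) : Finset (Fin n) := Z.biUnion endpts

/-- `verts Z` is the support of the graph with edge set `Z`. [folklore] -/
theorem supp_indVec (Z : Finset ((⊤ : SimpleGraph (Fin n)).edgeSet)) : supp (indVec Z) = verts Z := by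
  rw [supp_eq_biUnion, onSet_indVec]; rfl

/-- `|Z| ≤ C(|verts Z|, 2)`. [folklore] -/
theorem card_le_choose_card_verts (Z : Finset ((⊤ : SimpleGraph (Fin n)).edgeSet)) :
    #Z ≤ (#(verts Z)).choose 2 := by
  have := card_onSet_le_choose (indVec Z)
  rwa [onSet_indVec, supp_indVec] at this

/-- A nonempty edge set covers at least two vertices. [folklore] -/
theorem two_le_card_verts {Z : Finset ((⊤ : SimpleGraph (Fin n)).edgeSet)} (hZ : Z.Nonempty) :
    2 ≤ #(verts Z) := by
  obtain ⟨e, he⟩ := hZ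
  rw [← card_endpts e]
  exact card_le_card (subset_biUnion_of_mem endpts he)

/-- Edges inside `K_A` cover only vertices of `A`. [folklore] -/
theorem verts_subset_of_subset_onSet {Z : Finset ((⊤ : SimpleGraph (Fin n)).edgeSet)}
    {x : (⊤ : SimpleGraph (Fin n)).edgeSet → Bool} {A : Finset (Fin n)} (hZ : Z ⊆ onSet x)
    (hx : x ≤ cliqueVec A) : verts Z ⊆ A := by
  rw [← supp_indVec, ← le_cliqueVec_iff]
  exact ((indVec_le_iff Z x).2 hZ).trans hx

/-! ### Superset counts -/

/-- **`#{A ∈ ([n] choose k) : S ⊆ A} · n^{|S|} ≤ k^{|S|} · C(n,k)`** for `k ≤ n` (both sides are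
`0`-free of hypotheses on `|S|`: if `|S| > k` the left side vanishes). [folklore] -/
theorem card_filter_supset_mul_pow_le {k : ℕ} (hkn : k ≤ n) (S : Finset (Fin n)) :
    #((powersetCard k (univ : Finset (Fin n))).filter fun A => S ⊆ A) * n ^ #S ≤ k ^ #S * n.choose k := by
  by_cases hS : #S ≤ k
  · exact (Nat.mul_le_mul_right _ (card_filter_supset_le S)).trans (choose_sub_mul_pow_le_pow_mul_choose #S n k hS hkn)
  · have : ((powersetCard k (univ : Finset (Fin n))).filter fun A => S ⊆ A) = ∅ := by
      refine filter_false_of_mem fun A hA hSA => hS ?_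
      rw [(mem_powersetCard.1 hA).2.symm]
      exact card_le_card hSA
    rw [this, card_empty, zero_mul]
    exact Nat.zero_le _

/-! ### Spread families of cliques minus an edge -/

/-- Spreadness is monotone in the spread parameter. [folklore] -/
theorem isSpread_of_le {α : Type*} [DecidableEq α] {r R : ℝ} {F : Finset (Finset α)}
    (h : IsSpread R F) (hr : 0 < r) (hrR : r ≤ R) : IsSpread r F := by
  intro Z
  refine (h Z).trans (div_le_div_of_nonneg_left (Nat.cast_nonneg _) (pow_pos hr _) ?_)
  exact pow_le_pow_left₀ hr.le hrR _

/-- **Spread of a dense family of cliques minus an edge** (the input to the spread lemma in the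
proof of Rossman 2010, Lemma 15): let `Bad` be a family of `k`-subsets of `[n]`, `k ≤ n`,
`|Bad| ≥ θ · C(n,k)`, and `Q_A ⊆ K_A` subgraphs with `supp Q_A = A` (`A ∈ Bad`). If
`R^{|Z|} · k^{|V(Z)|} ≤ θ · n^{|V(Z)|}` for every nonempty `Z` contained in some `E(Q_A)`, then the
family `{E(Q_A) : A ∈ Bad}` is `R`-spread. [cite: Rossman2010, Lemma 15 (p. 9)] -/
theorem isSpread_image_of_clique_family {k : ℕ} (hkn : k ≤ n) (hn : 0 < n)
    (Bad : Finset (Finset (Fin n))) (hBad : Bad ⊆ powersetCard k univ)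
    (Q : Finset (Fin n) → (⊤ : SimpleGraph (Fin n)).edgeSet → Bool)
    (hQ : ∀ A ∈ Bad, Q A ≤ cliqueVec A ∧ supp (Q A) = A) {θ R : ℝ} (hR : 0 < R)
    (hθ : θ * n.choose k ≤ #Bad)
    (hcond : ∀ Z : Finset ((⊤ : SimpleGraph (Fin n)).edgeSet), Z.Nonempty →
      (∃ A ∈ Bad, Z ⊆ onSet (Q A)) → R ^ #Z * (k : ℝ) ^ #(verts Z) ≤ θ * (n : ℝ) ^ #(verts Z)) :
    IsSpread R (Bad.image fun A => onSet (Q A)) := by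
  set F := Bad.image fun A => onSet (Q A) with hF
  have hinj : Set.InjOn (fun A => onSet (Q A)) Bad := by
    intro A hA B hB h
    have h' : Q A = Q B := onSet_injective h
    rw [← (hQ A hA).2, ← (hQ B hB).2, h']
  have hcardF : #F = #Bad := card_image_of_injOn hinj
  intro Z
  rcases Z.eq_empty_or_nonempty with rfl | hZ
  · simp [hcardF]
  by_cases hex : ∃ A ∈ Bad, Z ⊆ onSet (Q A)
  · have hv : (#(F.filter fun T => Z ⊆ T) : ℝ) * (n : ℝ) ^ #(verts Z) ≤ (k : ℝ) ^ #(verts Z) * n.choose k := by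
      have h1 : #(F.filter fun T => Z ⊆ T) ≤ #((powersetCard k (univ : Finset (Fin n))).filter fun A => verts Z ⊆ A) := by
        calc #(F.filter fun T => Z ⊆ T)
            ≤ #((Bad.filter fun A => Z ⊆ onSet (Q A)).image fun A => onSet (Q A)) := by
              refine card_le_card fun T hT => ?_
              rw [mem_filter, hF, mem_image] at hT
              obtain ⟨⟨A, hA, rfl⟩, hZT⟩ := hT
              exact mem_image.2 ⟨A, mem_filter.2 ⟨hA, hZT⟩, rfl⟩
          _ ≤ #(Bad.filter fun A => Z ⊆ onSet (Q A)) := card_image_le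
          _ ≤ _ := by
              refine card_le_card fun A hA => ?_
              rw [mem_filter] at hA ⊢
              exact ⟨hBad hA.1, verts_subset_of_subset_onSet hA.2 (hQ A hA.1).1⟩
      have h2 := card_filter_supset_mul_pow_le hkn (verts Z)
      calc (#(F.filter fun T => Z ⊆ T) : ℝ) * (n : ℝ) ^ #(verts Z)
          ≤ #((powersetCard k (univ : Finset (Fin n))).filter fun A => verts Z ⊆ A) * (n : ℝ) ^ #(verts Z) := by
            exact mul_le_mul_of_nonneg_right (by exact_mod_cast h1) (by positivity)
        _ ≤ _ := by exact_mod_cast h2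
    have hc := hcond Z hZ hex
    have hnv : (0 : ℝ) < (n : ℝ) ^ #(verts Z) := by positivity
    have hRz : (0 : ℝ) < R ^ #Z := pow_pos hR _
    rw [le_div_iff₀ hRz, hcardF]
    -- #filter * R^z ≤ k^v C(n,k) R^z / n^v ≤ θ C(n,k) ≤ #Bad
    have hchoose : (0 : ℝ) ≤ n.choose k := Nat.cast_nonneg _
    have key : (#(F.filter fun T => Z ⊆ T) : ℝ) * R ^ #Z * (n : ℝ) ^ #(verts Z) ≤ #Bad * (n : ℝ) ^ #(verts Z) :=
      calc (#(F.filter fun T => Z ⊆ T) : ℝ) * R ^ #Z * (n : ℝ) ^ #(verts Z)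
          = (#(F.filter fun T => Z ⊆ T) : ℝ) * (n : ℝ) ^ #(verts Z) * R ^ #Z := by ring
        _ ≤ (k : ℝ) ^ #(verts Z) * n.choose k * R ^ #Z := mul_le_mul_of_nonneg_right hv hRz.le
        _ = (R ^ #Z * (k : ℝ) ^ #(verts Z)) * n.choose k := by ring
        _ ≤ θ * (n : ℝ) ^ #(verts Z) * n.choose k := mul_le_mul_of_nonneg_right hc hchoose
        _ = θ * n.choose k * (n : ℝ) ^ #(verts Z) := by ring
        _ ≤ #Bad * (n : ℝ) ^ #(verts Z) := mul_le_mul_of_nonneg_right hθ hnv.le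
    exact le_of_mul_le_mul_right key hnv
  · have : (F.filter fun T => Z ⊆ T) = ∅ := by
      refine filter_false_of_mem fun T hT hZT => hex ?_
      rw [hF, mem_image] at hT
      obtain ⟨A, hA, rfl⟩ := hT
      exact ⟨A, hA, hZT⟩
    rw [this, card_empty, Nat.cast_zero]
    positivity

end Literature.Computability.Complexity
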